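import Summits.RiemannHypothesis.RiemannHypothesis.Theorems.TiltedLandingLaw421R3SuccSplit
import Summits.RiemannHypothesis.RiemannHypothesis.Theorems.TiltedLandingLaw421R3Dimple

/-! # TiltedLandingLaw421 — round 3q SUPPORT: dimple signature + anti-escape corollary

SUPPORT module: discharges `RhW08.SuccSplit.DimpleSig` via `RhIdea3.G35.Landing.readyR2_of_dimple_state` and derives the
corollary `restSuccBotQ_of_antiEscape : AntiEscape → RestSuccBotQ` used by the by-name file.

Nothing here bears on the truth of RH; RH is not proved. -/

namespace RhW08.SuccSplit

/-- The dimple lemma signature is discharged by C3's state-glue lemma. -/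
theorem dimpleSig_holds : DimpleSig :=
  fun _ _ _ _ _ _ _ _ hE k u _ hv h1 h2 h3 =>
    RhIdea3.G35.Landing.readyR2_of_dimple_state hE k u hv h1 h2 h3

/-- ★ COROLLARY: `AntiEscape → RestSuccBotQ` (the by-name file applies this to the narrowed `AntiEscapeCore`). -/
theorem restSuccBotQ_of_antiEscape (hA : AntiEscape) : RhW08.SealSwapQ.RestSuccBotQ :=
  restSuccBotQ_of_pieces dimpleSig_holds hA

end RhW08.SuccSplit
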